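import Mathlib
import Summits.ValiantsHypothesis.ValiantsHypothesis.Theses.MonotoneRestoration
import Literature.Computability.AlgebraicComplexity.PatternExpressions
import Summits.ValiantsHypothesis.ValiantsHypothesis.Theorems.MonotoneRestorationMonotoneRestorationQPZetaPatterns

/-!
# Aside `MonotoneRestoration.OrbitCompressionQP` (stmt-ValiantsHypothesis-18332) — line `expression_compression`

Skeleton line (line-writer `linewriter-valiant-liouvmonotone-1-g0`, 2026-08-31).  The item is a BANKED
ASIDE (VH-free, not on the summit path, no provers seated); this file records the one cut of it with two
genuine halves, in the PATTERN-EXPRESSION currency in which the tree's engine THEOREM ζ-P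
(`Theorems.qpSymmetric_patternExpr`: closed labelled pattern expressions with polylog labels and
quasi-polynomial length ⇒ square-symmetric circuits of quasi-polynomial SIZE) is stated.

`OrbitCompressionQP`: a matrix-symmetric `VP` family over `ℂ` having square-symmetric circuits of
quasi-polynomial ORBIT size has square-symmetric circuits of quasi-polynomial SIZE.

* `stub_orbitToNarrowExpression` (VH-free STRUCTURE THEOREM TO PORT, L): a square-symmetric circuit of
  orbit size `≤ 2^{polylog}` computing `f_n` yields a closed pattern expression for `f_n` with `k + l`
  labels, `n^{k+l} ≤ 2^{polylog}` — of UNBOUNDED length.  This is the Dawar–Pago–Seppelt direction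
  "small orbits ⇒ rigidification ⇒ small supports (Dawar–Wilsenach support theorem) ⇒ every gate is a
  labelled quantity with labels = its support ⇒ the circuit is a pattern expression" (DPS25 Thm 1.1 /
  §4, proved there at polynomial scale; the support theorem holds for supports up to `~ n / log n`, so the
  quasi-polynomial scale is within range).  The tree has the ingredients of several support theorems
  (`Theorems/MonotoneRestorationMonotoneRestorationQPVariants*.lean: stub_gateSupport_var*`).
* `stub_narrowExpressionCompression` (OPEN, the `VP`-load-bearing half, IDEA-NEEDED): a matrix-symmetric
  `VP` family presented by narrow expressions of SOME length is presented by narrow expressions of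
  quasi-polynomial LENGTH.  Circuit- and automorphism-free; false without `VP` by the counting behind
  `OrbitCompressionFalseWithoutVP` (landed).  Modulo porting theorems of the first kind it is equivalent
  to the item — the transfer's teeth are only that it lives entirely in the bipartite graph algebra, where
  `VP` structure (depth reduction, homogeneous components, closure under coefficients) can be brought to
  bear on ONE syntactic object.
* `OrbitCompressionQP_of`: composition through THEOREM ζ-P (kernel-checked).
-/

set_option linter.dupNamespace false

namespace Summit.ValiantsHypothesis.ValiantsHypothesis.Cruxes.OrbitCompressionQP.ExpressionCompression

open Summit.ValiantsHypothesis.ValiantsHypothesis.Theses.MonotoneRestoration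
open Literature.Computability.AlgebraicComplexity

/-- **Stub 1 — orbits to narrow expressions (VH-free; Dawar–Pago–Seppelt extraction at the
quasi-polynomial scale; to port).** [cite: DawarPagoSeppelt2025, Theorem 1.1] [cite: DawarWilsenach2025, §3.3] -/
theorem stub_orbitToNarrowExpression :
    ∀ f : (n : ℕ) → MvPolynomial (Fin n × Fin n) ℂ,
      (∃ c : ℕ, ∀ n : ℕ, ∃ (G : Type) (_ : Fintype G)
          (C : LabelledArithCircuit ℂ (Fin n × Fin n) Unit G),
        C.IsSymmetric (Equiv.Perm (Fin n)) ∧ C.eval (C.output ()) = f n ∧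
        C.orbitSize (Equiv.Perm (Fin n)) ≤ 2 ^ ((Nat.log 2 n + c) ^ c)) →
      ∃ c : ℕ, ∀ n : ℕ, 1 ≤ n → ∃ (k l : ℕ) (e : PatternExpr ℂ k l),
        n ^ (k + l) ≤ 2 ^ ((Nat.log 2 n + c) ^ c) ∧ e.close n = f n := by
  sorry

/-- **Stub 2 — compression of narrow expressions for `VP` families (OPEN, `VP`-load-bearing).**
[cite: DwivediPagoSeppelt2026, Outlook Q3] [cite: DawarPagoSeppelt2025, §5] -/
theorem stub_narrowExpressionCompression :
    ∀ f : (n : ℕ) → MvPolynomial (Fin n × Fin n) ℂ,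
      (∀ (n : ℕ) (σ τ : Equiv.Perm (Fin n)),
        MvPolynomial.rename (fun p : Fin n × Fin n => (σ p.1, τ p.2)) (f n) = f n) →
      IsVPFamily f →
      (∃ c : ℕ, ∀ n : ℕ, 1 ≤ n → ∃ (k l : ℕ) (e : PatternExpr ℂ k l),
        n ^ (k + l) ≤ 2 ^ ((Nat.log 2 n + c) ^ c) ∧ e.close n = f n) →
      ∃ c : ℕ, ∀ n : ℕ, 1 ≤ n → ∃ (k l : ℕ) (e : PatternExpr ℂ k l),
        n ^ (k + l) ≤ 2 ^ ((Nat.log 2 n + c) ^ c) ∧ e.length ≤ 2 ^ ((Nat.log 2 n + c) ^ c) ∧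
        e.close n = f n := by
  sorry

/-- **Composition (kernel-checked):** Stub 1, Stub 2, then THEOREM ζ-P `Theorems.qpSymmetric_patternExpr`.
[folklore] -/
theorem OrbitCompressionQP_of : OrbitCompressionQP := by
  intro f hsymm hVP horb
  exact Summit.ValiantsHypothesis.ValiantsHypothesis.Theorems.qpSymmetric_patternExpr f
    (stub_narrowExpressionCompression f hsymm hVP (stub_orbitToNarrowExpression f horb))

end Summit.ValiantsHypothesis.ValiantsHypothesis.Cruxes.OrbitCompressionQP.ExpressionCompression
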